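/-
Copyright (c) 2026. All rights reserved.
Released under Apache 2.0 license as described in the file LICENSE.
Authors: abc-iut cell, statement-typer seat abc-iut-L4-t3 (wave 1; gen 7).
-/
import Literature.AnabelianGeometry.AbsoluteAnabelian.GaloisTheatersNumberFieldShadowRmk511
import Literature.AnabelianGeometry.AbsoluteAnabelian.GaloisTheatersAdmissible
import HarnessLib

/-!
# [AbsTopIII] Definition 5.1 (ii)/(iii): at the number-field arithmetic shadow, `V⊚(−)` and `k_NF(−)` ARE functors

S. Mochizuki, *Topics in absolute anabelian geometry III: global reconstruction algorithms*,
J. Math. Sci. Univ. Tokyo 22 (2015) 939–1156 [MochizukiAbsTopIII2015]; locators `p.N` = pages of the author's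
manuscript (`paper:url-5493eb38cbb7`), read on the page (own render `p0114.txt` l. 42, `p0115.txt` l. 15–20):
Def 5.1 (ii) p. 114 ("one may *functorially* construct “`V⊚(F̄/F)`”, “`V(F̄/F)`” from `Π_X`"), Def 5.1 (iii) p. 115
("Write `EA⊚` for the category whose objects are profinite groups isomorphic to `Π_X` for some `X` as in (ii), and whose
morphisms are open injections of profinite groups that induce isomorphisms between the respective maximal topologically
finitely generated closed normal subgroups").

WHY THIS FILE (PROOF-ONLY: no `def` / `structure` / `instance` / notation).  abc-iut-L4-d2 (gen 6) ASSEMBLED the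
[AbsTopIII] Def 5.1 (ii) context TERM `NumberFieldShadow.context F : GlobalAnabelianContext.{0}` at the number-field
arithmetic shadow (`GaloisTheatersNumberFieldShadowContext.lean`): `V⊚(f)` and `k_NF(f)` are translation by the
CONJUGATOR `τ_f ∈ G_ℚ` of the two `ℚ`-charts `ratChart E₁`, `ratChart E₂ ∘ f` (`NumberFieldShadow.conjugator`, a CHOICE;
`1` on the chartless component).  The frozen interface records `mapProVal`, `mapKNF` as bare data; the strict reading of
"functorially construct" — identities to identities, composites to composites — is the OPTIONAL law schema
`AdmGlobalAnabelianContext.IsFunctorial` of the print-faithful successor (this seat, gen 6; interface note I-L4-t3-1 of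
abc-iut-w5-d058), so far witnessed only DEGENERATELY (`GaloisTheatersAdmissibleFunctorialWitness.lean`); abc-iut-L4-d2's
`GaloisTheatersNumberFieldShadowRmk511.lean` proved the IDENTITY half at the shadow (`conjugator_id`, `context_mapKNF_id`,
`context_mapProVal_id`, consumed here BY NAME).  This file adds the COMPOSITION half, from the slimness of `G_ℚ`
(`VirtualChart.rat_hslim`, a tree theorem over Neukirch–Uchida), and assembles the law:

* `NumberFieldShadow.conjugator_unique` — on the charted component the conjugator is UNIQUE (two conjugators differ by
  an element centralising the open subgroup `ratChart E₁ (W) ≤ G_ℚ`, hence by `1`);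
* `conjugator_comp` — `τ_{f ≫ g} = τ_g · τ_f` (uniformly on both components);
* `context_mapKNF_comp`, `context_mapProVal_comp` — functoriality of `k_NF(−)`, `V⊚(−)` in COMPOSITES for the shadow
  context under the CURRENT (total) binder: every `E`, every `IsEAHom f`;
* `context_toAdm_isFunctorial : (NumberFieldShadow.context F).toAdm.IsFunctorial` — the law schema at a GENUINE carrier
  (`G_F`, `V⊚(ℚ̄/ℚ)` with its Galois action, `k_NF = ℚ̄`).

HONEST LABEL (as abc-iut-L4-d2's): the ARITHMETIC SHADOW (`Δ = 1`, stub archimedean geometry), NOT print's `EA⊚` of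
elliptically admissible hyperbolic orbicurves (no étale `π₁` in the tree; cell E-list E-L4-13); what is genuine is the
number-field Galois data and its functoriality in ALL open injections.  Inputs consumed BY NAME (`conjugator`,
`ratChart_comp_eq_conj`, `ratChart_spec`, `hasRatChart_iff_of_isEAHom`, `VirtualChart.rat_hslim`, `conjugator_id`); nothing
restated;
nothing here bears on the disputed [IUTchIII] Cor. 3.12 and no side is taken; shadow ≠ print's instance; typed ≠ proved.
-/

set_option autoImplicit false

open CategoryTheory Field
open scoped Pointwise

namespace Literature.AnabelianGeometry.AbsoluteAnabelian

namespace NumberFieldShadow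

/-! ### Uniqueness of the conjugator -/

/-- **The conjugator of a morphism of `EA⊚` is UNIQUE on the charted component**: if `Π_{E₁}` admits a `ℚ`-chart and
`τ ∈ G_ℚ` satisfies the chart-transition law `ratChart E₂ ∘ f = τ · ratChart E₁ · τ⁻¹`, then `τ = τ_f` — because
`τ_f⁻¹ τ` centralises the OPEN subgroup `ratChart E₁ (W)` of `G_ℚ`, which is slim (`VirtualChart.rat_hslim`,
Neukirch–Uchida). [cite: MochizukiAbsTopIII2015, Def 5.1 (iii) p. 115] -/
theorem conjugator_unique {E₁ E₂ : FundamentalExtension.{0}} (f : E₁ ⟶ E₂) (hf : IsEAHom f) (h₁ : HasRatChart E₁)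
    {τ : absoluteGaloisGroup ℚ} (hτ : ∀ g : E₁.arith, ratChart E₂ (f.arith g) = τ * ratChart E₁ g * τ⁻¹) :
    τ = conjugator f hf := by
  obtain ⟨W, -, -, hWo⟩ := ratChart_spec h₁
  -- `σ⁻¹ τ` centralises `ratChart E₁ (W)`, `σ := τ_f`
  have key : ∀ g : E₁.arith,
      (conjugator f hf)⁻¹ * τ * ratChart E₁ g * ((conjugator f hf)⁻¹ * τ)⁻¹ = ratChart E₁ g := by
    intro g
    have h : τ * ratChart E₁ g * τ⁻¹ = conjugator f hf * ratChart E₁ g * (conjugator f hf)⁻¹ := by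
      rw [← hτ g, ratChart_comp_eq_conj f hf g]
    calc (conjugator f hf)⁻¹ * τ * ratChart E₁ g * ((conjugator f hf)⁻¹ * τ)⁻¹
        = (conjugator f hf)⁻¹ * (τ * ratChart E₁ g * τ⁻¹) * conjugator f hf := by group
      _ = (conjugator f hf)⁻¹ * (conjugator f hf * ratChart E₁ g * (conjugator f hf)⁻¹) * conjugator f hf := by
          rw [h]
      _ = ratChart E₁ g := by group
  have hopen : IsOpen ((W.map (ratChart E₁).toMonoidHom : Subgroup (absoluteGaloisGroup ℚ)) :
      Set (absoluteGaloisGroup ℚ)) := by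
    rw [Subgroup.coe_map]
    exact hWo
  have h1 : (conjugator f hf)⁻¹ * τ = 1 := by
    refine VirtualChart.rat_hslim _ hopen _ ?_
    rintro _ ⟨g, -, rfl⟩
    exact key g
  exact (inv_mul_eq_one.mp h1).symm

/-- **`τ_{f ≫ g} = τ_g · τ_f`**: conjugators compose (uniqueness on the charted component; on the chartless component
all three are `1`, chartlessness being invariant along morphisms of `EA⊚`). [cite: MochizukiAbsTopIII2015, Def 5.1 (iii) p. 115] -/
theorem conjugator_comp {E₁ E₂ E₃ : FundamentalExtension.{0}} (f : E₁ ⟶ E₂) (g : E₂ ⟶ E₃) (hf : IsEAHom f)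
    (hg : IsEAHom g) (hfg : IsEAHom (f ≫ g)) : conjugator (f ≫ g) hfg = conjugator g hg * conjugator f hf := by
  by_cases h₁ : HasRatChart E₁
  · refine (conjugator_unique (f ≫ g) hfg h₁ fun x => ?_).symm
    rw [FundamentalExtension.comp_arith, ContinuousMonoidHom.comp_toFun, ratChart_comp_eq_conj g hg,
      ratChart_comp_eq_conj f hf, mul_inv_rev]
    group
  · have h₂ : ¬ HasRatChart E₂ := fun h => h₁ ((hasRatChart_iff_of_isEAHom f hf).mpr h)
    simp only [conjugator, dif_neg h₁, dif_neg h₂, mul_one]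

/-! ### Functoriality of `k_NF(−)` and `V⊚(−)` under the total binder -/

variable (F : Type) [Field F] [NumberField F]

/-- `k_NF(f)` IS the Galois action of the conjugator: `k_NF(f)(x) = τ_f · x` on `ℚ̄`.
[cite: MochizukiAbsTopIII2015, Def 5.1 (iii) p. 115] -/
theorem context_mapKNF_apply {E₁ E₂ : FundamentalExtension.{0}} (f : E₁ ⟶ E₂) (hf : IsEAHom f)
    (x : AlgebraicClosure ℚ) : (context F).mapKNF f hf x = conjugator f hf • x := rfl

/-- `V⊚(f)` IS translation by the conjugator on `V⊚(ℚ̄/ℚ)`: `V⊚(f)(v) = τ_f · v`.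
[cite: MochizukiAbsTopIII2015, Def 5.1 (iii) p. 115] -/
theorem context_mapProVal_apply {E₁ E₂ : FundamentalExtension.{0}} (f : E₁ ⟶ E₂) (hf : IsEAHom f)
    (v : (NumberField.valuationProSet ℚ).carrier) :
    (context F).mapProVal f hf v = (letI := (NumberField.valuationProSet ℚ).action; conjugator f hf • v) := rfl

/-- **`k_NF(f ≫ g) = k_NF(g) ∘ k_NF(f)`** at the shadow context, for ALL morphisms of `EA⊚`.
[cite: MochizukiAbsTopIII2015, Def 5.1 (ii) p. 114] -/
theorem context_mapKNF_comp {E₁ E₂ E₃ : FundamentalExtension.{0}} (f : E₁ ⟶ E₂) (g : E₂ ⟶ E₃) (hf : IsEAHom f)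
    (hg : IsEAHom g) (hfg : IsEAHom (f ≫ g)) (x : AlgebraicClosure ℚ) :
    (context F).mapKNF (f ≫ g) hfg x = (context F).mapKNF g hg ((context F).mapKNF f hf x) := by
  rw [context_mapKNF_apply, context_mapKNF_apply, context_mapKNF_apply, conjugator_comp f g hf hg hfg, mul_smul]

/-- **`V⊚(f ≫ g) = V⊚(g) ∘ V⊚(f)`** at the shadow context, for ALL morphisms of `EA⊚`.
[cite: MochizukiAbsTopIII2015, Def 5.1 (ii) p. 114] -/
theorem context_mapProVal_comp {E₁ E₂ E₃ : FundamentalExtension.{0}} (f : E₁ ⟶ E₂) (g : E₂ ⟶ E₃)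
    (hf : IsEAHom f) (hg : IsEAHom g) (hfg : IsEAHom (f ≫ g)) (v : ((context F).proVal E₁).carrier) :
    (context F).mapProVal (f ≫ g) hfg v = (context F).mapProVal g hg ((context F).mapProVal f hf v) := by
  letI := (NumberField.valuationProSet ℚ).action
  change conjugator (f ≫ g) hfg • (show (NumberField.valuationProSet ℚ).carrier from v) =
    conjugator g hg • conjugator f hf • (show (NumberField.valuationProSet ℚ).carrier from v)
  rw [conjugator_comp f g hf hg hfg, mul_smul]

/-- **At the number-field arithmetic shadow, `V⊚(−)` and `k_NF(−)` ARE functors on `EA⊚`** (the strict reading of Def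
5.1 (ii) "functorially construct", i.e. the optional law schema `AdmGlobalAnabelianContext.IsFunctorial` of the
print-faithful successor interface) — a GENUINE carrier: `G_F`, `V⊚(ℚ̄/ℚ)`, `k_NF = ℚ̄`; SHADOW (`Δ = 1`), not print's
`Π_X`. [cite: MochizukiAbsTopIII2015, Def 5.1 (ii) p. 114] -/
theorem context_toAdm_isFunctorial : (context F).toAdm.IsFunctorial where
  mapKNF_id E _ _ x := context_mapKNF_id F E x
  mapKNF_comp f g _ _ _ hf hg hfg x := context_mapKNF_comp F f g hf hg hfg x
  mapProVal_id E _ _ v := context_mapProVal_id F E v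
  mapProVal_comp f g _ _ _ hf hg hfg v := context_mapProVal_comp F f g hf hg hfg v

/-- **A GENUINE functorial inhabitant of the successor interface with a global Galois-theater**: the shadow context of
`F` restricted to `EA⊚` is functorial, `E_F` is admissible, and `GlobalGaloisTheater (context F)` is inhabited
(abc-iut-L4-d2's `NumberFieldShadow.theater F`). [cite: MochizukiAbsTopIII2015, Def 5.1 (iii) p. 115] -/
theorem exists_isFunctorial_genuine :
    ∃ R : GlobalAnabelianContext.{0}, R.toAdm.IsFunctorial ∧ R.IsAdmissible (extension F) ∧
      Nonempty (GlobalGaloisTheater R) :=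
  ⟨context F, context_toAdm_isFunctorial F, context_isAdmissible_extension F, ⟨theater F⟩⟩

end NumberFieldShadow

end Literature.AnabelianGeometry.AbsoluteAnabelian
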